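import Literature.AlgebraicGeometry.Motives.AbelianVarietyInvariantHomRank
import HarnessLib

/-!
# Symmetry and functoriality in the group of the equivariant Hom ranks:
# `rk Hom_{ℤ_ℓ[G]}(T_ℓ X, T_ℓ Y) = rk Hom_{ℤ_ℓ[G]}(T_ℓ Y, T_ℓ X)`; inflation and restriction

Two formal consequences of the `ℓ`-adic inner-product formula `|G| · rk_{ℤ_ℓ} Hom_{ℤ_ℓ[G]}(T_ℓ X, T_ℓ Y) = Σ_g χ_Y(g) χ_X(g⁻¹)`
(`Motives/AbelianVarietyEquivariantHomCharacterBound`) and of the shape `⋂_g eqLocus` of the equivariant submodules: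

* §1 **symmetry** — the pairing `Σ_g χ_Y(g) χ_X(g⁻¹)` is symmetric in `X`, `Y` (reindex `g ↦ g⁻¹`), hence for finite `G` and
  `ℓ` invertible in `K`
  **`rk_{ℤ_ℓ} Hom_{ℤ_ℓ[G]}(T_ℓ X, T_ℓ Y) = rk_{ℤ_ℓ} Hom_{ℤ_ℓ[G]}(T_ℓ Y, T_ℓ X)`** (`finrank_equivariantTateHom_symm`) — the lattice
  form of `dim Hom_G(V, W) = ⟨χ_V, χ_W⟩ = ⟨χ_W, χ_V⟩ = dim Hom_G(W, V)` (Serre §2.3, §7.2), with no semisimplicity argument;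
* §2 **inflation / restriction** along a homomorphism `φ : H → G` (actions pulled back to `H`): the `G`-equivariant maps are
  `H`-equivariant, `Hom_{ℤ_ℓ[G]} ⊆ Hom_{ℤ_ℓ[H]}` and `Hom_G(X, Y) ⊆ Hom_H(X, Y)` (`iInf_eqLocus_llcomp_lcomp_le_comp`,
  `iInf_eqLocus_leftComp_rightComp_le_comp`, with the rank inequalities `finrank_equivariantTateHom_le_comp`,
  `finrank_equivariantHom_le_comp`), with EQUALITY for `φ` surjective (inflation does not change equivariant maps:
  `iInf_eqLocus_llcomp_lcomp_comp_eq_of_surjective`, `iInf_eqLocus_leftComp_rightComp_comp_eq_of_surjective`).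

Everything is a theorem (no definitions, no named facts).

## References

* [SerreLinearRepresentations1977] J.-P. Serre, *Linear Representations of Finite Groups*, §2.3 (symmetry and bilinearity of
  `⟨φ, ψ⟩`), §7.1–§7.2 (restriction and `dim Hom_G(V, W) = ⟨χ_V, χ_W⟩`).
* [MumfordAV1970] D. Mumford, *Abelian Varieties* (1970), §19 Thm. 3 (pp. 176–178), Thm. 4 (p. 180).
* [LangeRodriguez2022] H. Lange, R. E. Rodríguez, *Decomposition of Jacobians by Prym Varieties*, LNM 2310 (2022), §2.9.1
  Prop. 2.9.3 (PDF p. 46).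
-/

noncomputable section

open CategoryTheory CategoryTheory.Limits
open Literature.RepresentationTheory.FiniteGroups
open Literature.NumberTheory.DiophantineGeometry

universe u

namespace Literature.AlgebraicGeometry.Motives

namespace AbelianVariety

variable {K : Type u} [Field K] (ℓ : ℕ) [Fact ℓ.Prime] {X Y : AbelianVariety K} {G H : Type} [Group G] [Group H]
  (ρX : G →* End X) (ρY : G →* End Y)

/-! ## §1 Symmetry: `rk Hom_{ℤ_ℓ[G]}(T_ℓ X, T_ℓ Y) = rk Hom_{ℤ_ℓ[G]}(T_ℓ Y, T_ℓ X)` -/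

/-- The `ℓ`-adic pairing is symmetric: `Σ_g χ_Y(g) χ_X(g⁻¹) = Σ_g χ_X(g) χ_Y(g⁻¹)` (reindex `g ↦ g⁻¹`).
[cite: SerreLinearRepresentations1977, §2.3 (⟨φ, ψ⟩ = ⟨ψ, φ⟩)] -/
theorem sum_trace_mul_trace_inv_symm [Fintype G] :
    ∑ g, LinearMap.trace ℤ_[ℓ] (Y.tateModule ℓ) (tateModuleMap ℓ (End.asHom (ρY g))) *
        LinearMap.trace ℤ_[ℓ] (X.tateModule ℓ) (tateModuleMap ℓ (End.asHom (ρX g⁻¹))) =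
      ∑ g, LinearMap.trace ℤ_[ℓ] (X.tateModule ℓ) (tateModuleMap ℓ (End.asHom (ρX g))) *
        LinearMap.trace ℤ_[ℓ] (Y.tateModule ℓ) (tateModuleMap ℓ (End.asHom (ρY g⁻¹))) :=
  Fintype.sum_equiv (Equiv.inv G) _ _ fun g ↦ by simp only [Equiv.inv_apply, inv_inv, mul_comm]

/-- **`rk_{ℤ_ℓ} Hom_{ℤ_ℓ[G]}(T_ℓ X, T_ℓ Y) = rk_{ℤ_ℓ} Hom_{ℤ_ℓ[G]}(T_ℓ Y, T_ℓ X)`** for finite-group actions on abelian varieties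
`X`, `Y` and `ℓ` invertible in `K`: both are `|G|⁻¹ Σ_g χ_Y(g) χ_X(g⁻¹) = |G|⁻¹ Σ_g χ_X(g) χ_Y(g⁻¹)` — the lattice form of
`dim Hom_G(V, W) = dim Hom_G(W, V)`, obtained from the character formula rather than from semisimplicity.
[cite: SerreLinearRepresentations1977, §2.3, §7.2] [cite: MumfordAV1970, §19 Thm. 3 (p. 176), Thm. 4 (p. 180)] -/
theorem finrank_equivariantTateHom_symm [Fintype G] (hℓ : (ℓ : K) ≠ 0) :
    Module.finrank ℤ_[ℓ]
        (⨅ g : G, LinearMap.eqLocus (LinearMap.llcomp ℤ_[ℓ] _ _ _ (tateModuleMap ℓ (End.asHom (ρY g))))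
          (LinearMap.lcomp ℤ_[ℓ] _ (tateModuleMap ℓ (End.asHom (ρX g)))) :
            Submodule ℤ_[ℓ] (X.tateModule ℓ →ₗ[ℤ_[ℓ]] Y.tateModule ℓ)) =
      Module.finrank ℤ_[ℓ]
        (⨅ g : G, LinearMap.eqLocus (LinearMap.llcomp ℤ_[ℓ] _ _ _ (tateModuleMap ℓ (End.asHom (ρX g))))
          (LinearMap.lcomp ℤ_[ℓ] _ (tateModuleMap ℓ (End.asHom (ρY g)))) :
            Submodule ℤ_[ℓ] (Y.tateModule ℓ →ₗ[ℤ_[ℓ]] X.tateModule ℓ)) := by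
  have h1 := card_mul_finrank_equivariantTateHom_eq_sum ℓ ρX ρY hℓ
  have h2 := card_mul_finrank_equivariantTateHom_eq_sum ℓ ρY ρX hℓ
  rw [sum_trace_mul_trace_inv_symm, ← h2] at h1
  exact Nat.cast_inj.1 (mul_left_cancel₀ (Nat.cast_ne_zero.2 Fintype.card_ne_zero) h1)

/-! ## §2 Inflation and restriction along `φ : H → G` -/

/-- **`Hom_{ℤ_ℓ[G]}(T_ℓ X, T_ℓ Y) ⊆ Hom_{ℤ_ℓ[H]}(T_ℓ X, T_ℓ Y)`** for the actions pulled back along any homomorphism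
`φ : H → G` (restriction to a subgroup, inflation from a quotient). [cite: SerreLinearRepresentations1977, §7.1 (restriction)] -/
theorem iInf_eqLocus_llcomp_lcomp_le_comp (φ : H →* G) :
    (⨅ g : G, LinearMap.eqLocus (LinearMap.llcomp ℤ_[ℓ] _ _ _ (tateModuleMap ℓ (End.asHom (ρY g))))
        (LinearMap.lcomp ℤ_[ℓ] _ (tateModuleMap ℓ (End.asHom (ρX g)))) :
          Submodule ℤ_[ℓ] (X.tateModule ℓ →ₗ[ℤ_[ℓ]] Y.tateModule ℓ)) ≤
      ⨅ h : H, LinearMap.eqLocus (LinearMap.llcomp ℤ_[ℓ] _ _ _ (tateModuleMap ℓ (End.asHom ((ρY.comp φ) h))))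
        (LinearMap.lcomp ℤ_[ℓ] _ (tateModuleMap ℓ (End.asHom ((ρX.comp φ) h)))) := by
  intro f hf
  rw [mem_iInf_eqLocus_llcomp_lcomp_iff] at hf ⊢
  exact fun h ↦ hf (φ h)

/-- For `φ : H → G` SURJECTIVE the pulled-back equivariant maps are the same: `Hom_{ℤ_ℓ[H]} = Hom_{ℤ_ℓ[G]}` (inflation).
[cite: SerreLinearRepresentations1977, §7.1] -/
theorem iInf_eqLocus_llcomp_lcomp_comp_eq_of_surjective (φ : H →* G) (hφ : Function.Surjective φ) :
    (⨅ h : H, LinearMap.eqLocus (LinearMap.llcomp ℤ_[ℓ] _ _ _ (tateModuleMap ℓ (End.asHom ((ρY.comp φ) h))))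
        (LinearMap.lcomp ℤ_[ℓ] _ (tateModuleMap ℓ (End.asHom ((ρX.comp φ) h)))) :
          Submodule ℤ_[ℓ] (X.tateModule ℓ →ₗ[ℤ_[ℓ]] Y.tateModule ℓ)) =
      ⨅ g : G, LinearMap.eqLocus (LinearMap.llcomp ℤ_[ℓ] _ _ _ (tateModuleMap ℓ (End.asHom (ρY g))))
        (LinearMap.lcomp ℤ_[ℓ] _ (tateModuleMap ℓ (End.asHom (ρX g)))) := by
  refine le_antisymm (fun f hf ↦ ?_) (iInf_eqLocus_llcomp_lcomp_le_comp ℓ ρX ρY φ)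
  rw [mem_iInf_eqLocus_llcomp_lcomp_iff] at hf ⊢
  intro g
  obtain ⟨h, rfl⟩ := hφ g
  exact hf h

/-- **`rk_{ℤ_ℓ} Hom_{ℤ_ℓ[G]}(T_ℓ X, T_ℓ Y) ≤ rk_{ℤ_ℓ} Hom_{ℤ_ℓ[H]}(T_ℓ X, T_ℓ Y)`** along any `φ : H → G` (`ℓ` invertible in `K`).
[cite: SerreLinearRepresentations1977, §7.1–§7.2] [cite: MumfordAV1970, §19 Thm. 3 (p. 176)] -/
theorem finrank_equivariantTateHom_le_comp (φ : H →* G) (hℓ : (ℓ : K) ≠ 0) :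
    Module.finrank ℤ_[ℓ]
        (⨅ g : G, LinearMap.eqLocus (LinearMap.llcomp ℤ_[ℓ] _ _ _ (tateModuleMap ℓ (End.asHom (ρY g))))
          (LinearMap.lcomp ℤ_[ℓ] _ (tateModuleMap ℓ (End.asHom (ρX g)))) :
            Submodule ℤ_[ℓ] (X.tateModule ℓ →ₗ[ℤ_[ℓ]] Y.tateModule ℓ)) ≤
      Module.finrank ℤ_[ℓ]
        (⨅ h : H, LinearMap.eqLocus (LinearMap.llcomp ℤ_[ℓ] _ _ _ (tateModuleMap ℓ (End.asHom ((ρY.comp φ) h))))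
          (LinearMap.lcomp ℤ_[ℓ] _ (tateModuleMap ℓ (End.asHom ((ρX.comp φ) h)))) :
            Submodule ℤ_[ℓ] (X.tateModule ℓ →ₗ[ℤ_[ℓ]] Y.tateModule ℓ)) := by
  haveI := X.module_free_tateModule_holds ℓ hℓ
  haveI := module_finite_tateModule_of_cast_ne_zero X ℓ hℓ
  haveI := Y.module_free_tateModule_holds ℓ hℓ
  haveI := module_finite_tateModule_of_cast_ne_zero Y ℓ hℓ
  exact Submodule.finrank_mono (iInf_eqLocus_llcomp_lcomp_le_comp ℓ ρX ρY φ)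

omit [Fact ℓ.Prime] in
/-- **`Hom_G(X, Y) ⊆ Hom_H(X, Y)`** for the actions pulled back along any `φ : H → G`. [cite: SerreLinearRepresentations1977, §7.1] -/
theorem iInf_eqLocus_leftComp_rightComp_le_comp (φ : H →* G) :
    (⨅ g : G, LinearMap.eqLocus (Preadditive.leftComp Y (End.asHom (ρX g))).toIntLinearMap
        (Preadditive.rightComp X (End.asHom (ρY g))).toIntLinearMap : Submodule ℤ (X ⟶ Y)) ≤
      ⨅ h : H, LinearMap.eqLocus (Preadditive.leftComp Y (End.asHom ((ρX.comp φ) h))).toIntLinearMap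
        (Preadditive.rightComp X (End.asHom ((ρY.comp φ) h))).toIntLinearMap := by
  intro f hf
  rw [mem_iInf_eqLocus_leftComp_rightComp_iff] at hf ⊢
  exact fun h ↦ hf (φ h)

omit [Fact ℓ.Prime] in
/-- For `φ : H → G` SURJECTIVE, `Hom_H(X, Y) = Hom_G(X, Y)` (inflation). [cite: SerreLinearRepresentations1977, §7.1] -/
theorem iInf_eqLocus_leftComp_rightComp_comp_eq_of_surjective (φ : H →* G) (hφ : Function.Surjective φ) :
    (⨅ h : H, LinearMap.eqLocus (Preadditive.leftComp Y (End.asHom ((ρX.comp φ) h))).toIntLinearMap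
        (Preadditive.rightComp X (End.asHom ((ρY.comp φ) h))).toIntLinearMap : Submodule ℤ (X ⟶ Y)) =
      ⨅ g : G, LinearMap.eqLocus (Preadditive.leftComp Y (End.asHom (ρX g))).toIntLinearMap
        (Preadditive.rightComp X (End.asHom (ρY g))).toIntLinearMap := by
  refine le_antisymm (fun f hf ↦ ?_) (iInf_eqLocus_leftComp_rightComp_le_comp ρX ρY φ)
  rw [mem_iInf_eqLocus_leftComp_rightComp_iff] at hf ⊢
  intro g
  obtain ⟨h, rfl⟩ := hφ g
  exact hf h

omit [Fact ℓ.Prime] in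
/-- **`rk_ℤ Hom_G(X, Y) ≤ rk_ℤ Hom_H(X, Y)`** along any `φ : H → G` (`Hom(X, Y)` is finitely generated, Mumford §19 Thm. 3).
[cite: SerreLinearRepresentations1977, §7.1] [cite: MumfordAV1970, §19 Thm. 3 (pp. 176–178)] -/
theorem finrank_equivariantHom_le_comp (φ : H →* G) :
    Module.finrank ℤ (⨅ g : G, LinearMap.eqLocus (Preadditive.leftComp Y (End.asHom (ρX g))).toIntLinearMap
        (Preadditive.rightComp X (End.asHom (ρY g))).toIntLinearMap : Submodule ℤ (X ⟶ Y)) ≤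
      Module.finrank ℤ (⨅ h : H, LinearMap.eqLocus (Preadditive.leftComp Y (End.asHom ((ρX.comp φ) h))).toIntLinearMap
        (Preadditive.rightComp X (End.asHom ((ρY.comp φ) h))).toIntLinearMap : Submodule ℤ (X ⟶ Y)) := by
  haveI : Module.Finite ℤ (X ⟶ Y) := module_finite_hom_holds X Y
  exact Submodule.finrank_mono (iInf_eqLocus_leftComp_rightComp_le_comp ρX ρY φ)

end AbelianVariety

end Literature.AlgebraicGeometry.Motives
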